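import Summits.KontsevichZagierPeriods.KontsevichZagierPeriods.Theorems.RootDecompRelativeModAbsoluteCylLogSplitP13

/-! # `RootDecompRelativeModAbsoluteCylLogSplitP14` — part 14/25 of the mechanical ≤330-line split of `CylLogSplit.lean`
(split by the decomp-kz census seat for landing; mathematics unchanged; part 14 continues part 13). -/

noncomputable section
open Set MeasureTheory Filter Topology
open scoped BigOperators
open Literature.NumberTheory.Transcendental Literature.ModelTheory.ExponentialFields

namespace Summit.KontsevichZagierPeriods.RootDecompRelativeModAbsolute.Rung30571

namespace RegularisedLogLayer

namespace CylLog
variable {b : ℕ}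

/-- Auxiliary step `integral_regKernel_le_pow`. [bookkeeping] -/
theorem integral_regKernel_le_pow (m : ℕ) {w : ℝ} (hw : 1 ≤ w) :
    ∫ t in (1:ℝ)..w, (t - 1) ^ m / t ≤ (w - 1) ^ (m + 1) := by
  have hsub : ∫ x in (1:ℝ)..w, (x - 1) ^ m = ∫ x in (1:ℝ) - 1..w - 1, x ^ m :=
    intervalIntegral.integral_comp_sub_right (fun t : ℝ => t ^ m) (1:ℝ)
  have hm1 : (1:ℝ) ≤ (m:ℝ) + 1 := by
    have := (Nat.cast_nonneg m : (0:ℝ) ≤ m)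
    linarith
  have hw0 : 0 ≤ w - 1 := by linarith
  calc ∫ t in (1:ℝ)..w, (t - 1) ^ m / t ≤ ∫ t in (1:ℝ)..w, (t - 1) ^ m := by
        refine intervalIntegral.integral_mono_on hw (intervalIntegrable_regKernel m one_pos hw)
          ((by fun_prop : Continuous fun t : ℝ => (t - 1) ^ m).intervalIntegrable _ _) fun t ht => ?_
        exact div_le_self (pow_nonneg (by linarith [ht.1]) _) ht.1
    _ = (w - 1) ^ (m + 1) / (m + 1) := by rw [hsub, sub_self, integral_pow]; simp
    _ ≤ (w - 1) ^ (m + 1) := div_le_self (pow_nonneg hw0 _) hm1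

/-- **The base defect is small near `(1,1)`**: `|ρ_m(u,w)| ≤ (uw−1)^{m+1}` for `u, w ≥ 1`. -/
theorem abs_rho_le (m : ℕ) {u w : ℝ} (hu : 1 ≤ u) (hw : 1 ≤ w) :
    |rho m u w| ≤ (u * w - 1) ^ (m + 1) := by
  have hu0 : 0 < u := by linarith
  have hw0 : 0 < w := by linarith
  have hu_le : u ≤ u * w := le_mul_of_one_le_right hu0.le hw
  have hw_le : w ≤ u * w := le_mul_of_one_le_left hw0.le hu
  have huw : 1 ≤ u * w := hu.trans hu_le
  rw [← integral_reg_kernel_mul m hu0 hw0]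
  have hI : ∫ t in (1:ℝ)..(u * w), (t - 1) ^ m / t ≤ (u * w - 1) ^ (m + 1) :=
    integral_regKernel_le_pow m huw
  have hA0 : 0 ≤ ∫ t in (1:ℝ)..u, (t - 1) ^ m / t := integral_regKernel_nonneg m hu
  have hB0 : 0 ≤ ∫ t in (1:ℝ)..w, (t - 1) ^ m / t := integral_regKernel_nonneg m hw
  have hAI : ∫ t in (1:ℝ)..u, (t - 1) ^ m / t ≤ ∫ t in (1:ℝ)..(u * w), (t - 1) ^ m / t :=
    integral_regKernel_mono m hu hu_le
  have hBI : ∫ t in (1:ℝ)..w, (t - 1) ^ m / t ≤ ∫ t in (1:ℝ)..(u * w), (t - 1) ^ m / t :=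
    integral_regKernel_mono m hw hw_le
  rw [abs_le]
  constructor <;> linarith

/-- **Existence of the base term** `[G, d·ρ_m(u,w)]` from `d·(uw−1)^{m+1} ∈ L¹(G)` (`u, w ≥ 1`). -/
theorem exists_baseRep_rho {b m : ℕ} {G : Set (Fin b → ℝ)} {d u w : (Fin b → ℝ) → ℝ}
    (hG : IsSemialgebraic ℚ G) (hd : IsSemialgebraicFunOn ℚ G d) (hu : IsSemialgebraicFunOn ℚ G u)
    (hw : IsSemialgebraicFunOn ℚ G w) (hu1 : ∀ x ∈ G, 1 ≤ u x) (hw1 : ∀ x ∈ G, 1 ≤ w x)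
    (hint : IntegrableOn (fun x => d x * (u x * w x - 1) ^ (m + 1)) G) :
    ∃ B : KZ.IntegralRep b, B.domain = G ∧ B.integrand = fun x => d x * rho m (u x) (w x) := by
  have hGm : MeasurableSet G := hG.measurableSet_holds
  have hsa : IsSemialgebraicFunOn ℚ G (fun x => d x * rho m (u x) (w x)) :=
    (IsSemialgebraicFunOn.mul_holds hd
      (IsSemialgebraicFunOn.sub_holds (IsSemialgebraicFunOn.sub_holds
        (isSemialgebraicFunOn_polyLog_comp hG (IsSemialgebraicFunOn.mul_holds hu hw) m)
        (isSemialgebraicFunOn_polyLog_comp hG hu m))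
        (isSemialgebraicFunOn_polyLog_comp hG hw m))).congr fun x _ => by simp [rho]
  have hKn : IntegrableOn (fun x => ‖d x * (u x * w x - 1) ^ (m + 1)‖) G := hint.norm
  have hB : IntegrableOn (fun x => d x * rho m (u x) (w x)) G := by
    refine Integrable.mono' hKn (KZ.aestronglyMeasurable_of_isSemialgebraicFunOn hsa hGm) ?_
    filter_upwards [ae_restrict_mem hGm] with x hx
    have h1 : (1:ℝ) ≤ u x * w x := (hu1 x hx).trans (le_mul_of_one_le_right (by linarith [hu1 x hx]) (hw1 x hx))
    rw [Real.norm_eq_abs, Real.norm_eq_abs, abs_mul, abs_mul,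
      abs_of_nonneg (pow_nonneg (sub_nonneg.mpr h1) (m + 1))]
    exact mul_le_mul_of_nonneg_left (abs_rho_le m (hu1 x hx) (hw1 x hx)) (abs_nonneg _)
  exact ⟨{ domain := G, integrand := fun x => d x * rho m (u x) (w x), isSemialgebraic_domain := hG,
           isSemialgebraicFunOn_integrand := hsa, integrableOn := hB }, rfl, rfl⟩

/-- Auxiliary step `isSemialgebraicFunOn_fin_prod`. [bookkeeping] -/
theorem isSemialgebraicFunOn_fin_prod {b : ℕ} {G : Set (Fin b → ℝ)} (hG : IsSemialgebraic ℚ G) :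
    ∀ {k : ℕ} {W : Fin k → (Fin b → ℝ) → ℝ}, (∀ i, IsSemialgebraicFunOn ℚ G (W i)) →
      IsSemialgebraicFunOn ℚ G (fun x => ∏ i, W i x)
  | 0, W, _ => by simpa using isSemialgebraicFunOn_ratCast hG 1
  | k + 1, W, hW => by
    have ih := isSemialgebraicFunOn_fin_prod hG (W := fun i => W (Fin.castSucc i)) fun i => hW _
    exact (IsSemialgebraicFunOn.mul_holds ih (hW (Fin.last k))).congr fun x _ => by
      simp [Fin.prod_univ_castSucc]

/-- Auxiliary step `differentiableOn_fin_prod`. [bookkeeping] -/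
theorem differentiableOn_fin_prod {b : ℕ} {G : Set (Fin b → ℝ)} :
    ∀ {k : ℕ} {W : Fin k → (Fin b → ℝ) → ℝ}, (∀ i, DifferentiableOn ℝ (W i) G) →
      DifferentiableOn ℝ (fun x => ∏ i, W i x) G
  | 0, W, _ => by
    simp only [Finset.univ_eq_empty, Finset.prod_empty]
    exact differentiableOn_const _
  | k + 1, W, hW => by
    have ih := differentiableOn_fin_prod (W := fun i => W (Fin.castSucc i)) fun i => hW _
    simp only [Fin.prod_univ_castSucc]
    exact ih.mul (hW (Fin.last k))

/-- Auxiliary step `one_le_fin_prod`. [bookkeeping] -/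
theorem one_le_fin_prod : ∀ {k : ℕ} {a : Fin k → ℝ}, (∀ i, 1 ≤ a i) → 1 ≤ ∏ i, a i
  | 0, a, _ => by simp
  | k + 1, a, h => by
    rw [Fin.prod_univ_castSucc]
    exact one_le_mul_of_one_le_of_one_le (one_le_fin_prod fun i => h _) (h _)

/-- Auxiliary step `isSemialgebraicFunOn_polyLogDefect`. [bookkeeping] -/
theorem isSemialgebraicFunOn_polyLogDefect {b m k : ℕ} {G : Set (Fin b → ℝ)} {d : (Fin b → ℝ) → ℝ}
    {W : Fin k → (Fin b → ℝ) → ℝ} (hG : IsSemialgebraic ℚ G) (hd : IsSemialgebraicFunOn ℚ G d)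
    (hW : ∀ i, IsSemialgebraicFunOn ℚ G (W i)) :
    IsSemialgebraicFunOn ℚ G
      (fun x => d x * (polyLog m (∏ i, W i x) - ∑ i, polyLog m (W i x))) := by
  have hsum : IsSemialgebraicFunOn ℚ G (fun x => ∑ i ∈ Finset.univ, polyLog m (W i x)) :=
    KZ.isSemialgebraicFunOn_finset_sum Finset.univ hG fun i _ =>
      isSemialgebraicFunOn_polyLog_comp hG (hW i) m
  exact IsSemialgebraicFunOn.mul_holds hd (IsSemialgebraicFunOn.sub_holds
    (isSemialgebraicFunOn_polyLog_comp hG (isSemialgebraicFunOn_fin_prod hG hW) m) hsum)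

/-- **D7, positive orientation, `k` factors (iterated torus product).**  Over an open `ℚ`-semialgebraic base `G`,
let `d` be `ℚ`-semialgebraic and `W₁,…,W_k ≥ 1` `ℚ`-semialgebraic and differentiable with `d·(∏Wᵢ − 1)^{m+1} ∈ L¹(G)`,
and let `Rᵢ` be honest representations of the regularised cells `P_m(d, Wᵢ) = [band G 1 Wᵢ, d (t−1)^m/t]`.  Then the
product cell `P = P_m(d, ∏ Wᵢ)` and the base term `B = [G, d·(polyLog_m(∏ Wᵢ) − Σᵢ polyLog_m(Wᵢ))]` EXIST as honest
representations and `[P] − Σᵢ [Rᵢ] − [B] ∈ KZ.relations`. -/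
theorem regTorusProductPos_iter {b m : ℕ} {G : Set (Fin b → ℝ)} {d : (Fin b → ℝ) → ℝ}
    (hGo : IsOpen G) (hG : IsSemialgebraic ℚ G) (hd : IsSemialgebraicFunOn ℚ G d) :
    ∀ (k : ℕ) (W : Fin k → (Fin b → ℝ) → ℝ),
      (∀ i, IsSemialgebraicFunOn ℚ G (W i)) → (∀ i, DifferentiableOn ℝ (W i) G) →
      (∀ i, ∀ x ∈ G, 1 ≤ W i x) →
      IntegrableOn (fun x => d x * (∏ i, W i x - 1) ^ (m + 1)) G →
      ∀ (R : Fin k → KZ.IntegralRep (b + 1)),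
        (∀ i, (R i).domain = KZlog.band G (fun _ => 1) (W i)) →
        (∀ i, EqOn (R i).integrand
          (fun z => d (Fin.init z) * ((z (Fin.last b) - 1) ^ m / z (Fin.last b))) (R i).domain) →
        ∃ (P : KZ.IntegralRep (b + 1)) (B : KZ.IntegralRep b),
          P.domain = KZlog.band G (fun _ => 1) (fun x => ∏ i, W i x) ∧
          (P.integrand = fun z => d (Fin.init z) * ((z (Fin.last b) - 1) ^ m / z (Fin.last b))) ∧
          B.domain = G ∧
          (B.integrand = fun x => d x * (polyLog m (∏ i, W i x) - ∑ i, polyLog m (W i x))) ∧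
          KZ.of P - ∑ i, KZ.of (R i) - KZ.of B ∈ KZ.relations
  | 0, W, hW, hWd, hW1, hint, R, hRd, hRi => by
    have hGm : MeasurableSet G := hG.measurableSet_holds
    obtain ⟨P, hPd, hPi⟩ := exists_regRep_of_integrableOn_pow (m := m) (W := fun x => ∏ i, W i x)
      hG hd (isSemialgebraicFunOn_fin_prod hG hW) (fun x _ => by simp) hint
    have hBsa := isSemialgebraicFunOn_polyLogDefect (m := m) hG hd hW
    have hBint : IntegrableOn
        (fun x => d x * (polyLog m (∏ i, W i x) - ∑ i, polyLog m (W i x))) G := by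
      refine (integrableOn_zero : IntegrableOn (fun _ : Fin b → ℝ => (0:ℝ)) G).congr_fun
        (fun x _ => ?_) hGm
      simp [polyLog_one]
    set B : KZ.IntegralRep b :=
      { domain := G
        integrand := fun x => d x * (polyLog m (∏ i, W i x) - ∑ i, polyLog m (W i x))
        isSemialgebraic_domain := hG
        isSemialgebraicFunOn_integrand := hBsa
        integrableOn := hBint } with hB
    refine ⟨P, B, hPd, hPi, rfl, rfl, ?_⟩
    have hP : KZ.of P ∈ KZ.relations := by
      refine KZ.of_mem_relations_of_volume_eq_zero P ?_
      rw [hPd]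
      refine measure_mono_null (fun z hz => ?_) (KZ.volume_setOf_last_eq_zero (n := b) 1)
      obtain ⟨_, h1, h2⟩ := hz
      have h1' : (1:ℝ) ≤ z (Fin.last b) := h1
      have h2' : z (Fin.last b) ≤ ∏ i : Fin 0, W i (Fin.init z) := h2
      simp only [Finset.univ_eq_empty, Finset.prod_empty] at h2'
      exact le_antisymm h2' h1'
    have hB0 : KZ.of B ∈ KZ.relations :=
      KZ.of_mem_relations_of_eqOn_zero B fun x _ => by simp [hB, polyLog_one]
    have e : KZ.of P - ∑ i : Fin 0, KZ.of (R i) - KZ.of B = KZ.of P - KZ.of B := by simp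
    rw [e]
    exact sub_mem hP hB0
  | k + 1, W, hW, hWd, hW1, hint, R, hRd, hRi => by
    have hGm : MeasurableSet G := hG.measurableSet_holds
    -- the partial product and the last factor
    set Pk : (Fin b → ℝ) → ℝ := fun x => ∏ i : Fin k, W (Fin.castSucc i) x with hPk
    have hQsa : IsSemialgebraicFunOn ℚ G Pk :=
      isSemialgebraicFunOn_fin_prod hG (W := fun i => W (Fin.castSucc i)) fun i => hW _
    have hQd : DifferentiableOn ℝ Pk G :=
      differentiableOn_fin_prod (W := fun i => W (Fin.castSucc i)) fun i => hWd _
    have hQ1 : ∀ x ∈ G, 1 ≤ Pk x := fun x hx => one_le_fin_prod fun i => hW1 _ x hx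
    have hl1 : ∀ x ∈ G, 1 ≤ W (Fin.last k) x := hW1 (Fin.last k)
    have hprod : ∀ x, ∏ i, W i x = Pk x * W (Fin.last k) x := fun x => by
      simp [hPk, Fin.prod_univ_castSucc]
    have hQle : ∀ x ∈ G, Pk x ≤ Pk x * W (Fin.last k) x := fun x hx =>
      le_mul_of_one_le_right (by linarith [hQ1 x hx]) (hl1 x hx)
    -- integrability of the partial-product bound (domination)
    have hint' : IntegrableOn (fun x => d x * (Pk x * W (Fin.last k) x - 1) ^ (m + 1)) G :=
      hint.congr_fun (fun x _ => by
        show d x * (∏ i, W i x - 1) ^ (m + 1) = d x * (Pk x * W (Fin.last k) x - 1) ^ (m + 1)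
        rw [hprod]) hGm
    have hintk : IntegrableOn (fun x => d x * (Pk x - 1) ^ (m + 1)) G := by
      have hsa : IsSemialgebraicFunOn ℚ G (fun x => d x * (Pk x - 1) ^ (m + 1)) :=
        IsSemialgebraicFunOn.mul_holds hd (isSemialgebraicFunOn_pow' hG
          ((IsSemialgebraicFunOn.sub_holds hQsa (isSemialgebraicFunOn_ratCast hG 1)).congr
            fun x _ => by simp) (m + 1))
      refine Integrable.mono' hint'.norm (KZ.aestronglyMeasurable_of_isSemialgebraicFunOn hsa hGm) ?_
      filter_upwards [ae_restrict_mem hGm] with x hx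
      rw [Real.norm_eq_abs, Real.norm_eq_abs, abs_mul, abs_mul,
        abs_of_nonneg (pow_nonneg (sub_nonneg.mpr (hQ1 x hx)) (m + 1)),
        abs_of_nonneg (pow_nonneg (sub_nonneg.mpr ((hQ1 x hx).trans (hQle x hx))) (m + 1))]
      refine mul_le_mul_of_nonneg_left ?_ (abs_nonneg _)
      exact pow_le_pow_left₀ (sub_nonneg.mpr (hQ1 x hx)) (by linarith [hQle x hx]) _
    -- induction hypothesis on the first k factors
    obtain ⟨Pk, Bk, hPkd, hPki, hBkd, hBki, hrelk⟩ :=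
      regTorusProductPos_iter hGo hG hd k (fun i => W (Fin.castSucc i)) (fun i => hW _) (fun i => hWd _)
        (fun i => hW1 _) hintk (fun i => R (Fin.castSucc i)) (fun i => hRd _) (fun i => hRi _)
    -- the product cell and the new base defect exist
    obtain ⟨P, hPd, hPi⟩ := exists_regRep_of_integrableOn_pow (m := m) (W := fun x => ∏ i, W i x)
      hG hd (isSemialgebraicFunOn_fin_prod hG hW)
      (fun x hx => one_le_fin_prod fun i => hW1 i x hx) hint
    obtain ⟨B', hB'd, hB'i⟩ := exists_baseRep_rho (m := m) hG hd hQsa (hW (Fin.last k)) hQ1 hl1 hint'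
    -- one two-factor torus product
    have hstep : KZ.of P - KZ.of Pk - KZ.of (R (Fin.last k)) - KZ.of B' ∈ KZ.relations :=
      regTorusProductPos hGo hG hd hQsa (hW (Fin.last k)) hQd hQ1 hl1 P Pk (R (Fin.last k)) B'
        (by rw [hPd]; congr 1; funext x; exact hprod x) (fun z _ => by rw [hPi])
        hPkd (fun z _ => by rw [hPki]) (hRd (Fin.last k)) (hRi (Fin.last k))
        hB'd (fun x _ => by rw [hB'i])
    -- the telescoped base term
    have hBsa := isSemialgebraicFunOn_polyLogDefect (m := m) hG hd hW
    have hsum : ∀ x, d x * (polyLog m (∏ i, W i x) - ∑ i, polyLog m (W i x)) =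
        Bk.integrand x + B'.integrand x := fun x => by
      rw [hBki, hB'i]
      simp only [rho, hPk, Fin.prod_univ_castSucc, Fin.sum_univ_castSucc]
      ring
    have hBk_int : IntegrableOn Bk.integrand G := by
      have h := Bk.integrableOn
      rwa [hBkd] at h
    have hB'_int : IntegrableOn B'.integrand G := by
      have h := B'.integrableOn
      rwa [hB'd] at h
    have hBint : IntegrableOn
        (fun x => d x * (polyLog m (∏ i, W i x) - ∑ i, polyLog m (W i x))) G :=
      (hBk_int.add hB'_int).congr_fun (fun x _ => (hsum x).symm) hGm
    set B : KZ.IntegralRep b :=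
      { domain := G
        integrand := fun x => d x * (polyLog m (∏ i, W i x) - ∑ i, polyLog m (W i x))
        isSemialgebraic_domain := hG
        isSemialgebraicFunOn_integrand := hBsa
        integrableOn := hBint } with hB
    have hBrel : KZ.of B - KZ.of Bk - KZ.of B' ∈ KZ.relations :=
      KZ.integrandAddRel_subset_relations ⟨b, B, Bk, B', hBkd, hB'd, fun x _ => hsum x, rfl⟩
    refine ⟨P, B, hPd, hPi, rfl, rfl, ?_⟩
    have e : KZ.of P - ∑ i : Fin (k + 1), KZ.of (R i) - KZ.of B =
        (KZ.of P - KZ.of Pk - KZ.of (R (Fin.last k)) - KZ.of B') +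
          (KZ.of Pk - ∑ i : Fin k, KZ.of (R (Fin.castSucc i)) - KZ.of Bk) -
          (KZ.of B - KZ.of Bk - KZ.of B') := by
      rw [Fin.sum_univ_castSucc]
      abel
    rw [e]
    exact sub_mem (add_mem hstep hrelk) hBrel

end CylLog
end RegularisedLogLayer
end Summit.KontsevichZagierPeriods.RootDecompRelativeModAbsolute.Rung30571
end
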